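import Summits.QuantumAdvantage.AdviceFreeQNC0.WalkCoreEvenTriple
import Summits.QuantumAdvantage.AdviceFreeQNC0.WindowLocalization
import HarnessLib

/-!
# Cell qa-qnc0 (rung F-Q1, route RingFrame, crux α): the hub `MixedHardPolylog ↔ WalkHardAll`
# (planner qa-qnc0-p1 ROUND-9 §2, Sketch10 §22.2 `MixedHardIffWalkHard`, ask P9)

Statements VERBATIM from `Sketch10.lean` §22.2 (`WalkHardAll`, `MixedHardPolylog`,
`MixedHardIffWalkHard`) and PROVED:

* `mixedHardPolylog_iff_walkHardAll : MixedHardIffWalkHard`.  `→`: qn-prover-3's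
  `ringWinU_le_of_mixedHardAt` (`WindowLocalization.lean`, `P ≡ 0`, `ℓ = n`).  `←`: a mixed win
  pattern `P_{|w|} ⊕ WIN_y` is the win pattern of the walk strategy `y_P ⊕ y` of degree `D + 1`
  (E4 `evenTriple_isWalkRow` + `ringWinU_xor`), and `(log₂ ℓ)^C + 1 ≤ (log₂ ℓ)^{C+1}` for `ℓ ≥ 4`.

So the walk game at ALL charges and polylog degree (what the LDMA route delivers, `WalkHardAll`;
the registered `RingHardU` is its charge `n + 2`) and qn-prover-3's mixed game at polylog degree are
the SAME statement.  WHAT THIS IS NOT: `RingHardU → WalkHardAll` (E6, charge propagation), E2/E3,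
W1–W3 are not in this file (the topic must not import the route's `Theorems` defs); nothing on α.
-/

noncomputable section

namespace Summit.QuantumAdvantage.AdviceFreeQNC0

open Finset
open Literature.Computability.MetaComplexity Literature.Computability.MetaComplexity.Smolensky

/-- walk hardness at ALL charges (verbatim from `Sketch10` §22.2). -/
def WalkHardAll : Prop :=
  ∃ θ : ℝ, θ < 1 ∧ ∀ C : ℕ, ∃ n₀ : ℕ, ∀ n ≥ n₀, ∀ c : ℕ, ∀ y : Fin (n + 1) → (Fin n → Bool) → Bool,
    (∀ g, HasDeg (y g) ((Nat.log 2 n) ^ C)) →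
      ((univ.filter fun u : Fin n → Bool => ringWinU c y u = true).card : ℝ) ≤ θ * (2 : ℝ) ^ n

/-- mixed hardness at polylog degree (verbatim from `Sketch10` §22.2). -/
def MixedHardPolylog : Prop :=
  ∃ θ : ℝ, θ < 1 ∧ ∀ C : ℕ, ∃ ℓ₀ : ℕ, ∀ ℓ ≥ ℓ₀, MixedHardAt ℓ ((Nat.log 2 ℓ) ^ C) θ

/-- the hub (verbatim from `Sketch10` §22.2). -/
def MixedHardIffWalkHard : Prop := MixedHardPolylog ↔ WalkHardAll

/-- Polylog bookkeeping: `(log₂ ℓ)^C + 1 ≤ (log₂ ℓ)^{C+1}` for `ℓ ≥ 4`. -/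
theorem log_pow_succ_le {ℓ : ℕ} (hℓ : 4 ≤ ℓ) (C : ℕ) : (Nat.log 2 ℓ) ^ C + 1 ≤ (Nat.log 2 ℓ) ^ (C + 1) := by
  have h2 : 2 ≤ Nat.log 2 ℓ := Nat.le_log_of_pow_le (by norm_num) (by omega)
  have h1 : 1 ≤ (Nat.log 2 ℓ) ^ C := Nat.one_le_pow _ _ (by omega)
  rw [pow_succ]
  nlinarith

/-- **The hub `MixedHardPolylog ↔ WalkHardAll`.** -/
theorem mixedHardPolylog_iff_walkHardAll : MixedHardIffWalkHard := by
  constructor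
  · -- `→`: the walk game is the mixed game with the zero triple
    rintro ⟨θ, hθ, h⟩
    refine ⟨θ, hθ, fun C => ?_⟩
    obtain ⟨ℓ₀, hℓ₀⟩ := h C
    exact ⟨ℓ₀, fun n hn c y hy => ringWinU_le_of_mixedHardAt (hℓ₀ n hn) n le_rfl c y hy⟩
  · -- `←`: a mixed win pattern is the win pattern of the walk strategy `y_P ⊕ y` of degree `D + 1`
    rintro ⟨θ, hθ, h⟩
    refine ⟨θ, hθ, fun C => ?_⟩
    obtain ⟨n₀, hn₀⟩ := h (C + 1)
    refine ⟨max n₀ 4, fun ℓ hℓ c P y hPdeg hPeven hy => ?_⟩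
    have hℓ4 : 4 ≤ ℓ := le_trans (le_max_right _ _) hℓ
    have hℓ1 : 1 ≤ ℓ := by omega
    -- the even triple as a walk strategy of degree `D + 1`
    obtain ⟨yP, hyP, hwin⟩ := evenTriple_isWalkRow ℓ hℓ1 c ((Nat.log 2 ℓ) ^ C) P ⟨hPdeg, hPeven⟩
    -- the mixed win pattern is the win pattern of `yP ⊕ y`
    have e : (univ.filter fun w : Fin ℓ → Bool => mixedWinU c P y w = true) =
        univ.filter fun w : Fin ℓ → Bool => ringWinU c (fun g w => xor (yP g w) (y g w)) w = true := by
      refine Finset.filter_congr fun w _ => ?_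
      unfold mixedWinU
      have hw : P (wt w % 3) w = ringWinU c yP w := hwin w
      rw [hw, ringWinU_xor]
    rw [e]
    refine hn₀ ℓ (le_trans (le_max_left _ _) hℓ) c _ fun g => ?_
    have hdeg := hasDeg_xor (hyP g) (hasDeg_of_le (hy g) (Nat.le_succ _))
    exact hasDeg_of_le hdeg (log_pow_succ_le hℓ4 C)

end Summit.QuantumAdvantage.AdviceFreeQNC0

end
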